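/-
Copyright (c) 2026 the pub-hodgecm-mathlib formalisation cell (harness21).  Prover seat hodgecm-mathlib-LH4-p13 (g6): Track A «(D-RAM) FOUR-FRAME» squad of crux H413,
unit U2H (ii-H), census leaf (ρ2b′-X) — socket (B) (type RamK bottom; lead LH4-p07 (g7)), organ (B-top∕ε): THE HERMITIAN-NORM CRITERION, 2026-09-04.
-/
import Summits.HodgeConjecture.HodgeConjecture.Theorems.F0P3cDyRamTokenFrameGlueRamK       -- ★ p857977 (this seat): `exists_thetaFixed_unramified_generator`
import Summits.HodgeConjecture.HodgeConjecture.Theorems.F0P3cDyRamTopDepthRamKSuppliers     -- ★ p857954 (this seat): `exists_thetaFixed_norm_near`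
import Literature.NumberTheory.LocalFields.WildQuadraticDatumNonNormUnit                  -- ★ (LH4-p02 lineage): `exists_unit_nonnorm_dichotomy_of_isRamifiedQuadraticDatum`
import Literature.NumberTheory.LocalFields.ValuedCompleteIsAdicComplete                   -- ★ `isAdicComplete_valuedInteger_of_completeSpace`
import HarnessLib

/-!
# F0 · P3c · line LH4 «(D-RAM) FOUR-FRAME» — socket (B), organ (B-top∕ε): the hermitian-norm criterion on type RamK
(Serre 1979 Ch. V §2 Prop. 3, §3 Cor. 3; Rogawski 1990 §4.9)

Cell `pub/hodgecm-mathlib`, crux H413 = `stmt-HodgeConjecture-24833` (helper lane, count-neutral); THEOREMS ONLY (no definition, no instance, no notation, no named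
fact, no `sorry`).  ONE-FIELD letters of the (ρ2b′-X) line models: `K` stands for the completed third field `M = E′_{w₁}` with its two commuting isometric involutions
`ρ` (fixed field `E = L_w`) and `Θ` (fixed field `K♮ := M^Θ`), `F := E ∩ K♮ = L⁺_v`; `ϖE` a `ρ`-fixed uniformiser with `IsRamifiedQuadraticDatum Θ ϖE d t` (type RamK:
`M ∕ M^Θ` is a ramified quadratic datum with the letters of `L_w ∕ L⁺_v`), `|2| < 1` (the dyadic letter `h2v` of :418), and the type-(B) generator letters `|α| ≤ 1`,
`|α − ρα| = 1`, `|α − Θα| < 1` (socket `SOCKET-hOCB.v1` 17cfa65d).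

WHAT IS PROVED.
* §2 `two_le_of_datum_of_v_two_lt_one`: `|2| < 1` and the datum force `1 ≤ t`, `t` even-compatible bound `d ≤ t + 1`, and `2 ≤ d` (clause 4 at `x = 2` and at `x = ϖE + ΘϖE`).
* §1 `norm_mul_map_norm_eq`: the identity `(x·Θx)·ρ(x·Θx) = (x·ρx)·Θ(x·ρx)` (`N_{K♮∕F} ∘ N_{M∕K♮} = N_{E∕F} ∘ N_{M∕E}`).
* §3 **`side_iff_exists_norm`** — THE CRITERION: for a `Θ`-fixed `κ ≠ 0`,
  `(∃ x j, |x| = 1 ∧ x·Θx = κ·(ϖE·ΘϖE)^j) ↔ ∃ e, ρe = e ∧ e·Θe = κ·ρκ`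
  («`κ` is a unit hermitian norm up to a power of `π₂ = ϖE·ΘϖE` iff `N_{K♮∕F} κ` is a norm from `E`»).  ELEMENTARY (no class field theory): `⟹` is §1; `⟸` uses the ★ unit
  dichotomy with a non-norm witness on `(M, Θ, ϖE)` (`exists_unit_nonnorm_dichotomy_of_isRamifiedQuadraticDatum`), the ★ near-one norm surjectivity of the UNRAMIFIED `K♮ ∕ F`
  (★ p857954 `exists_thetaFixed_norm_near`, generator `αK := α·Θα` of ★ p857977), and ONE named input `hf₀`: a principal unit of `F` which is NOT a norm from `E` (the head
  discharges it from ★ `WildQuadraticDatumNonNormUnitLevel.exists_fixed_unit_not_norm_of_level` at level `1 ≤ d − 1` on `L_w`, transported along `ι_{w₁}`).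
* §4 `exists_mul_theta_eq_of_fixed_fixed` — COROLLARY `hNF`: every `(ρ, Θ)`-fixed unit is a hermitian norm `x·Θx` (the `hNF` HYPOTHESIS of ★ p857819 §5 ∕ ★ p857764 (4),
  now discharged from the frame + `hf₀`).

HONEST LABEL: HC_CM is proved only modulo the 7 printed citations (2 remaining named inputs: hLiu418 = stmt-HodgeConjecture-24832, h413 = stmt-HodgeConjecture-24833) until rung 0
closes; (ρ2b′-X) :418 is an OPEN prover target — this file is a helper (`--supports`), proofs only; socket (B) is OPEN.

## References
* [Serre1979] J.-P. Serre, *Local Fields*, GTM 67 (1979), Ch. V §2 Prop. 3 (unramified norms), §3 Cor. 3 (ramified quadratic norm index).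
* [Rogawski1990] J. D. Rogawski, *Automorphic Representations of Unitary Groups in Three Variables*, Ann. of Math. Stud. 123 (1990), §4.9 pp. 55–56.
* [NeukirchANT1999] J. Neukirch, *Algebraic Number Theory* (1999), Ch. V (1.3).
-/

set_option autoImplicit false

noncomputable section

open WithZero IsLocalRing
open scoped Valued

namespace Summit.HodgeConjecture.HodgeConjecture.Cruxes.H413.F0P3cDyRamSideNormCriterionRamK

open Literature.NumberTheory.Automorphic.UnitaryThreeFourFrame (IsRamifiedQuadraticDatum)
open Literature.NumberTheory.LocalFields.WildQuadraticDatum (v_varpi_pow exists_unit_nonnorm_dichotomy_of_isRamifiedQuadraticDatum)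
open Literature.NumberTheory.LocalFields (isAdicComplete_valuedInteger_of_completeSpace)
open Summit.HodgeConjecture.HodgeConjecture.Cruxes.H413.F0P3cDyRamTokenFrameGlueRamK (exists_thetaFixed_unramified_generator)
open Summit.HodgeConjecture.HodgeConjecture.Cruxes.H413.F0P3cDyRamTopDepthRamKSuppliers (exists_thetaFixed_norm_near)

variable {K : Type} [Field K] {ρ Θ : K →+* K}

/-! ## §1 The norm-composition identity (no valuation) -/

/-- **`N_{K♮∕F}(N_{M∕K♮} x) = N_{E∕F}(N_{M∕E} x)`** for commuting `ρ`, `Θ`: `(x·Θx)·ρ(x·Θx) = (x·ρx)·Θ(x·ρx)`. [cite: Serre1979, Ch. V §2] -/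
theorem norm_mul_map_norm_eq (hΘρ : ∀ x, Θ (ρ x) = ρ (Θ x)) (x : K) :
    x * Θ x * ρ (x * Θ x) = x * ρ x * Θ (x * ρ x) := by
  rw [map_mul, map_mul, hΘρ]; ring

variable [Valued K ℤᵐ⁰]

/-! ## §2 Datum numerics at a dyadic place; a unit lemma -/

/-- **`|2| < 1` AND THE DATUM FORCE `1 ≤ t`, `d ≤ t + 1`, `2 ≤ d`.**  Clause 7 gives `|2| = |ϖ|^t`, so `1 ≤ t`; clause 4 (Θ-fixed non-zero elements have EVEN
valuation) at `x = 2` makes `t` even, at `x = ϖ + Θϖ = 2ϖ − (ϖ − Θϖ)` it forbids `|ϖ + Θϖ| ∈ {exp(−(t+1)), exp(−1)}`, whence `d ≤ t + 1` and `d ≠ 1`.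
[cite: Serre1979, Ch. V §3 Cor. 3] [cite: Serre1979, Ch. III §6 Prop. 13] -/
theorem two_le_of_datum_of_v_two_lt_one {ϖ : K} {d t : ℕ} (hD : IsRamifiedQuadraticDatum Θ ϖ d t) (h2 : Valued.v (2 : K) < 1) :
    2 ≤ d ∧ d ≤ t + 1 ∧ 1 ≤ t := by
  obtain ⟨hΘΘ, hΘv, hϖ, heven, hdϖ, hd1, h2t⟩ := hD
  have hπ : ∀ n : ℕ, Valued.v ϖ ^ n = exp (-(n : ℤ)) := v_varpi_pow hϖ
  rw [hπ] at h2t hdϖ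
  have hϖ0 : ϖ ≠ 0 := fun h => by rw [h, map_zero] at hϖ; exact (exp_ne_zero hϖ.symm).elim
  have h20 : (2 : K) ≠ 0 := fun h => by rw [h, map_zero] at h2t; exact (exp_ne_zero h2t.symm).elim
  -- `1 ≤ t`
  have ht1 : 1 ≤ t := by
    by_contra h0
    have ht0 : t = 0 := by omega
    rw [ht0, Nat.cast_zero, neg_zero, exp_zero] at h2t
    exact absurd h2t (ne_of_lt h2)
  -- `t` is even
  obtain ⟨n₂, hn₂⟩ := heven 2 (map_ofNat Θ 2) h20
  rw [hn₂] at h2t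
  have ht2 : 2 * n₂ = -(t : ℤ) := exp_injective h2t
  -- the Θ-fixed element `ϖ + Θϖ`
  have hΘx : Θ (ϖ + Θ ϖ) = ϖ + Θ ϖ := by rw [map_add, hΘΘ, add_comm]
  have hx : ϖ + Θ ϖ = 2 * ϖ + -(ϖ - Θ ϖ) := by ring
  have hx' : ϖ + Θ ϖ = -(ϖ - Θ ϖ) + 2 * ϖ := by ring
  have h2ϖ : Valued.v (2 * ϖ) = exp (-((t : ℤ) + 1)) := by
    rw [Valuation.map_mul, hn₂, hϖ, ← exp_add]; congr 1; omega
  have hneg : Valued.v (-(ϖ - Θ ϖ)) = exp (-(d : ℤ)) := by rw [Valuation.map_neg, hdϖ]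
  refine ⟨?_, ?_, ht1⟩
  · -- `2 ≤ d`: if `d = 1` then `|ϖ + Θϖ| = exp(−1)` is odd
    by_contra hlt
    have hd : d = 1 := by omega
    have hlt' : Valued.v (2 * ϖ) < Valued.v (-(ϖ - Θ ϖ)) := by
      rw [h2ϖ, hneg, exp_lt_exp]; omega
    have hvx : Valued.v (ϖ + Θ ϖ) = exp (-(d : ℤ)) := by
      rw [hx', Valuation.map_add_eq_of_lt_left _ hlt', hneg]
    have hx0 : ϖ + Θ ϖ ≠ 0 := fun h => by rw [h, map_zero] at hvx; exact (exp_ne_zero hvx.symm).elim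
    obtain ⟨n, hn⟩ := heven _ hΘx hx0
    rw [hn] at hvx
    have := exp_injective hvx
    omega
  · -- `d ≤ t + 1`: if `t + 2 ≤ d` then `|ϖ + Θϖ| = exp(−(t+1))` is odd (`t` even)
    by_contra hlt
    have hlt' : Valued.v (-(ϖ - Θ ϖ)) < Valued.v (2 * ϖ) := by
      rw [h2ϖ, hneg, exp_lt_exp]; omega
    have hvx : Valued.v (ϖ + Θ ϖ) = exp (-((t : ℤ) + 1)) := by
      rw [hx, Valuation.map_add_eq_of_lt_left _ hlt', h2ϖ]
    have hx0 : ϖ + Θ ϖ ≠ 0 := fun h => by rw [h, map_zero] at hvx; exact (exp_ne_zero hvx.symm).elim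
    obtain ⟨n, hn⟩ := heven _ hΘx hx0
    rw [hn] at hvx
    have := exp_injective hvx
    omega

/-- `x·Θx` a unit ⇒ `x` a unit (`Θ` isometric). [cite: Serre1979, Ch. II §2] -/
theorem v_eq_one_of_mul_theta_eq (hΘv : ∀ x, Valued.v (Θ x) = Valued.v x) {x k : K} (hxk : x * Θ x = k) (hk : Valued.v k = 1) :
    Valued.v x = 1 := by
  have h : Valued.v x * Valued.v x = 1 := by rw [← hk, ← hxk, Valuation.map_mul, hΘv]
  rcases lt_trichotomy (Valued.v x) 1 with h1 | h1 | h1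
  · exfalso
    have hlt : Valued.v x * Valued.v x < 1 := mul_lt_one' h1 h1
    rw [h] at hlt
    exact lt_irrefl _ hlt
  · exact h1
  · exfalso
    have hlt : 1 < Valued.v x * Valued.v x := one_lt_mul'' h1 h1
    rw [h] at hlt
    exact lt_irrefl _ hlt

/-! ## §3 The criterion: `κ·π₂^ℤ ∩ N_{M∕K♮}(𝒪_Mˣ) ≠ ∅ ⟺ N_{K♮∕F} κ ∈ N_{E∕F}(Eˣ)` -/

/-- **THE HERMITIAN-NORM CRITERION ON TYPE RamK.**  Frame: `ρ` involutive isometric, commuting with `Θ`; `IsRamifiedQuadraticDatum Θ ϖE d t` with `ρϖE = ϖE`; `|2| < 1`;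
the type-(B) generator letters `|α| ≤ 1`, `|α − ρα| = 1`, `|α − Θα| < 1`; `[CompleteSpace K] [Finite 𝓀[K]]`; and ONE named input `hf₀` — a `(ρ,Θ)`-fixed `f₀` with
`|f₀ − 1| < 1` which is NOT of the form `e·Θe` with `ρe = e` (a principal unit of `F` that is not a norm from `E`).  Then for every `Θ`-fixed `κ ≠ 0`:
`(∃ x j, |x| = 1 ∧ x·Θx = κ·(ϖE·ΘϖE)^j) ↔ (∃ e, ρe = e ∧ e·Θe = κ·ρκ)`.
`⟹`: §1 with `e := x·ρx ∕ π₂^j`.  `⟸`: normalise `k := κ·π₂^n` to a unit (clause 4); if `k ∉ N`, the ★ dichotomy (`u ∈ N ∨ c·u ∈ N` for `Θ`-fixed units, `c ∉ N`) applied to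
`k` and to a `Θ`-fixed `g₀` with `g₀·ρg₀ = f₀` (★ p857954; `g₀ ∉ N` by §1 and `hf₀`) puts `k·g₀ = N(y₁y₂∕c)` in `N`, so by §1 `k·ρk·f₀ ∈ N_{E∕F}`, and dividing by
`k·ρk ∈ N_{E∕F}` contradicts `hf₀`. [cite: Serre1979, Ch. V §2 Prop. 3] [cite: Serre1979, Ch. V §3 Cor. 3] [cite: Rogawski1990, §4.9 pp. 55–56] -/
theorem side_iff_exists_norm [CompleteSpace K] [Finite 𝓀[K]]
    (hρρ : ∀ x, ρ (ρ x) = x) (hvρ : ∀ x, Valued.v (ρ x) = Valued.v x) (hΘρ : ∀ x, Θ (ρ x) = ρ (Θ x))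
    {ϖE : K} {d t : ℕ} (hD : IsRamifiedQuadraticDatum Θ ϖE d t) (hρϖ : ρ ϖE = ϖE) (h2 : Valued.v (2 : K) < 1)
    {α : K} (hα1 : Valued.v α ≤ 1) (hα : Valued.v (α - ρ α) = 1) (hram : Valued.v (α - Θ α) < 1)
    (hf₀ : ∃ f₀ : K, ρ f₀ = f₀ ∧ Θ f₀ = f₀ ∧ Valued.v (f₀ - 1) < 1 ∧ ¬ ∃ e : K, ρ e = e ∧ e * Θ e = f₀)
    {κ : K} (hΘκ : Θ κ = κ) (hκ0 : κ ≠ 0) :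
    (∃ x : K, ∃ j : ℤ, Valued.v x = 1 ∧ x * Θ x = κ * (ϖE * Θ ϖE) ^ j) ↔ ∃ e : K, ρ e = e ∧ e * Θ e = κ * ρ κ := by
  have hD' := hD
  obtain ⟨hΘΘ, hΘv, hϖE, heven, -, -, h2t⟩ := hD'
  have hρΘ : ∀ x, ρ (Θ x) = Θ (ρ x) := fun x => (hΘρ x).symm
  have hϖ0 : ϖE ≠ 0 := fun h => by rw [h, map_zero] at hϖE; exact (exp_ne_zero hϖE.symm).elim
  -- the `F`-element `π₂ := ϖE·ΘϖE`
  set π₂ := ϖE * Θ ϖE with hπ₂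
  have hρπ₂ : ρ π₂ = π₂ := by rw [hπ₂, map_mul, hρϖ, hρΘ, hρϖ]
  have hΘπ₂ : Θ π₂ = π₂ := by rw [hπ₂, map_mul, hΘΘ, mul_comm]
  have hvπ₂ : Valued.v π₂ = exp (-2 : ℤ) := by
    rw [hπ₂, Valuation.map_mul, hΘv, hϖE, ← exp_add]; rfl
  have hπ₂0 : π₂ ≠ 0 := fun h => by rw [h, map_zero] at hvπ₂; exact (exp_ne_zero hvπ₂.symm).elim
  have hNN : ∀ x : K, x * Θ x * ρ (x * Θ x) = x * ρ x * Θ (x * ρ x) := norm_mul_map_norm_eq hΘρ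
  constructor
  · -- ## `⟹`: `κρκ = N_{E∕F}(xρx ∕ π₂^j)`
    rintro ⟨x, j, -, hx⟩
    have hpj : π₂ ^ j ≠ 0 := zpow_ne_zero j hπ₂0
    refine ⟨x * ρ x / π₂ ^ j, ?_, ?_⟩
    · rw [map_div₀, map_mul, map_zpow₀, hρπ₂, hρρ, mul_comm (ρ x) x]
    · have h1 : x * ρ x * Θ (x * ρ x) = κ * ρ κ * (π₂ ^ j * π₂ ^ j) := by
        rw [← hNN, hx, map_mul, map_zpow₀, hρπ₂]; ring
      rw [map_div₀, map_zpow₀, hΘπ₂, div_mul_div_comm, h1]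
      field_simp
  · -- ## `⟸`
    rintro ⟨e, hρe, he⟩
    -- unit normalisation `k := κ·π₂^n`
    obtain ⟨n, hn⟩ := heven κ hΘκ hκ0
    set k := κ * π₂ ^ n with hk
    have hΘk : Θ k = k := by rw [hk, map_mul, map_zpow₀, hΘκ, hΘπ₂]
    have hvk : Valued.v k = 1 := by
      rw [hk, Valuation.map_mul, map_zpow₀, hn, hvπ₂, ← exp_zsmul, ← exp_add, ← exp_zero]
      congr 1; simp only [smul_eq_mul]; ring
    have hk0 : k ≠ 0 := fun h => by rw [h, map_zero] at hvk; exact zero_ne_one hvk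
    have hρk0 : ρ k ≠ 0 := (map_ne_zero ρ).2 hk0
    -- `k·ρk = N_{E∕F}(e·π₂^n)`
    have hρeπ : ρ (e * π₂ ^ n) = e * π₂ ^ n := by rw [map_mul, map_zpow₀, hρe, hρπ₂]
    have hke : e * π₂ ^ n * Θ (e * π₂ ^ n) = k * ρ k := by
      rw [map_mul, map_zpow₀, hΘπ₂, hk, map_mul, map_zpow₀, hρπ₂]
      linear_combination (π₂ ^ n * π₂ ^ n) * he
    have heπ0 : e * π₂ ^ n ≠ 0 := by
      intro h0
      rw [h0, zero_mul] at hke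
      exact mul_ne_zero hk0 hρk0 hke.symm
    -- it suffices to put `k` in `N`
    suffices hy : ∃ y : K, y * Θ y = k by
      obtain ⟨y, hy⟩ := hy
      exact ⟨y, n, v_eq_one_of_mul_theta_eq hΘv hy hvk, by rw [hy, hk]⟩
    -- suppliers: adic completeness, the unit dichotomy with a non-norm witness, the unramified generator, near-one `K♮∕F` surjectivity
    haveI : IsAdicComplete 𝓂[K] 𝒪[K] := isAdicComplete_valuedInteger_of_completeSpace hϖE
    obtain ⟨c, hΘc, hvc, hcn, hdich⟩ := exists_unit_nonnorm_dichotomy_of_isRamifiedQuadraticDatum Θ ϖE d t hD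
    obtain ⟨f₀, hρf₀, hΘf₀, hf₀1, hf₀n⟩ := hf₀
    obtain ⟨αK, hΘαK, hαK1, hαKρ⟩ := exists_thetaFixed_unramified_generator hΘΘ hρΘ hvρ hΘv h2 hα1 hα hram
    have h20 : (2 : K) ≠ 0 := by
      intro h
      rw [h, map_zero, v_varpi_pow hϖE] at h2t
      exact (exp_ne_zero h2t.symm).elim
    obtain ⟨g₀, hΘg₀, hg₀f, hg₀1⟩ := exists_thetaFixed_norm_near hρρ hρΘ hvρ hΘv h20 hΘαK hαK1 hαKρ hρf₀ hΘf₀ hf₀1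
    have hvg₀ : Valued.v g₀ = 1 := by
      have hlt : Valued.v (g₀ - 1) < Valued.v (1 : K) := by rw [Valuation.map_one]; exact hg₀1.trans_lt hf₀1
      have h := Valuation.map_add_eq_of_lt_left _ hlt
      rwa [add_sub_cancel, Valuation.map_one] at h
    have hc0 : c ≠ 0 := fun h => by rw [h, map_zero] at hvc; exact zero_ne_one hvc
    -- `g₀ ∉ N` (else `f₀ = N_{E∕F}(yρy)`)
    have hg₀n : ¬ ∃ y : K, y * Θ y = g₀ := by
      rintro ⟨y, hy⟩
      refine hf₀n ⟨y * ρ y, by rw [map_mul, hρρ, mul_comm (ρ y) y], ?_⟩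
      rw [← hNN, hy, hg₀f]
    by_contra hkn
    -- dichotomy: `c·k`, `c·g₀ ∈ N`, hence `k·g₀ = N(y₁y₂∕c)`
    obtain ⟨y₁, hy₁⟩ := (hdich k hΘk hvk).resolve_left hkn
    obtain ⟨y₂, hy₂⟩ := (hdich g₀ hΘg₀ hvg₀).resolve_left hg₀n
    have hkg : y₁ * y₂ / c * Θ (y₁ * y₂ / c) = k * g₀ := by
      rw [map_div₀, map_mul, hΘc]
      field_simp
      linear_combination (y₂ * Θ y₂) * hy₁ + (c * k) * hy₂
    -- so `k·ρk·f₀ = N_{E∕F}(Y·ρY)` with `Y := y₁y₂∕c`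
    have hYY : y₁ * y₂ / c * ρ (y₁ * y₂ / c) * Θ (y₁ * y₂ / c * ρ (y₁ * y₂ / c)) = k * ρ k * f₀ := by
      rw [← hNN, hkg, map_mul, ← hg₀f]; ring
    -- divide by `k·ρk = N_{E∕F}(e·π₂^n)`: `f₀` would be a norm from `E`
    have hquot : ∀ Y D : K, D ≠ 0 → D * Θ D = k * ρ k → Y * Θ Y = k * ρ k * f₀ → Y / D * Θ (Y / D) = f₀ := by
      intro Y D hD0 hDD hY
      rw [map_div₀, div_mul_div_comm, hY, hDD]
      field_simp
    refine hf₀n ⟨y₁ * y₂ / c * ρ (y₁ * y₂ / c) / (e * π₂ ^ n), ?_, hquot _ _ heπ0 hke hYY⟩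
    rw [map_div₀, map_mul, hρρ, hρeπ, mul_comm (ρ (y₁ * y₂ / c)) (y₁ * y₂ / c)]

/-! ## §4 Corollary `hNF`: `(ρ, Θ)`-fixed units are hermitian norms -/

/-- **`𝒪_Fˣ ⊆ N_{M∕K♮}(𝒪_Mˣ)` ON TYPE RamK** (the `hNF` hypothesis of ★ p857819 §5 and ★ p857764 (4), discharged): under the frame of `side_iff_exists_norm`, every
`(ρ, Θ)`-fixed unit `f` is `x·Θx` — §3 at `κ := f` (`f·ρf = f·Θf`), the exponent `j` being `0` by valuations. [cite: Serre1979, Ch. V §2 Prop. 3] [cite: Serre1979, Ch. V §3 Cor. 3] -/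
theorem exists_mul_theta_eq_of_fixed_fixed [CompleteSpace K] [Finite 𝓀[K]]
    (hρρ : ∀ x, ρ (ρ x) = x) (hvρ : ∀ x, Valued.v (ρ x) = Valued.v x) (hΘρ : ∀ x, Θ (ρ x) = ρ (Θ x))
    {ϖE : K} {d t : ℕ} (hD : IsRamifiedQuadraticDatum Θ ϖE d t) (hρϖ : ρ ϖE = ϖE) (h2 : Valued.v (2 : K) < 1)
    {α : K} (hα1 : Valued.v α ≤ 1) (hα : Valued.v (α - ρ α) = 1) (hram : Valued.v (α - Θ α) < 1)
    (hf₀ : ∃ f₀ : K, ρ f₀ = f₀ ∧ Θ f₀ = f₀ ∧ Valued.v (f₀ - 1) < 1 ∧ ¬ ∃ e : K, ρ e = e ∧ e * Θ e = f₀)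
    {f : K} (hρf : ρ f = f) (hΘf : Θ f = f) (hf1 : Valued.v f = 1) : ∃ x : K, x * Θ x = f := by
  have hΘv : ∀ x, Valued.v (Θ x) = Valued.v x := hD.2.1
  have hϖE : Valued.v ϖE = exp (-1 : ℤ) := hD.2.2.1
  have hf0 : f ≠ 0 := fun h => by rw [h, map_zero] at hf1; exact zero_ne_one hf1
  obtain ⟨x, j, hx1, hx⟩ :=
    (side_iff_exists_norm hρρ hvρ hΘρ hD hρϖ h2 hα1 hα hram hf₀ hΘf hf0).2 ⟨f, hρf, by rw [hΘf, hρf]⟩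
  have hvπ₂ : Valued.v (ϖE * Θ ϖE) = exp (-2 : ℤ) := by
    rw [Valuation.map_mul, hΘv, hϖE, ← exp_add]; rfl
  have hj : j = 0 := by
    have h := congrArg Valued.v hx
    rw [Valuation.map_mul, hΘv, hx1, one_mul, Valuation.map_mul, hf1, one_mul, map_zpow₀, hvπ₂, ← exp_zsmul, ← exp_zero] at h
    have h' := exp_injective h
    simp only [smul_eq_mul] at h'
    omega
  exact ⟨x, by rw [hx, hj, zpow_zero, mul_one]⟩

end Summit.HodgeConjecture.HodgeConjecture.Cruxes.H413.F0P3cDyRamSideNormCriterionRamK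

end
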